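import Literature.Geometry.Riemannian.DistanceDirectionalData
import Literature.Geometry.Riemannian.DirectionalBarrierMinimumPrinciple
import HarnessLib

/-!
# Laplacian comparison for the distance function under `Ric ≥ -(m-1)` and `Ric ≥ 0`
# (Calabi's barrier / viscosity form), from the second variation of arc length

Let `(M, g)` be a connected Riemannian manifold of dimension `m`, modelled on the finite
dimensional inner product space `E`, with geodesically complete Levi-Civita connection, and let
`r = d(p, ·)` be the distance from `p`. The classical **Laplacian comparison theorem** (E. Calabi
1958; Cheeger–Colding 1996, §1 "mean curvature / Laplacian comparison", the infinitesimal form of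
the relative volume comparison (0.5) of Cheeger–Colding 1997; Lee 2018, Thm. 11.15; Petersen 2016,
Lemma 7.1.9; Schoen–Yau, Thm. 1.1.1) says

* `Ric ≥ -(m-1) g  ⟹  Δ r ≤ (m-1) coth r`,
* `Ric ≥ 0         ⟹  Δ r ≤ (m-1) / r`,

at smooth points of `r`, and everywhere on `M ∖ {p}` IN THE BARRIER SENSE OF CALABI — the form
in which it is used throughout the Cheeger–Colding theory (maximum principle arguments: the
Abresch–Gromoll excess estimate, Cheng–Yau gradient estimates, almost splitting). We PROVE the
barrier form in its sharpest pointwise ("viscosity supersolution") rendering: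

* `laplaceBeltrami_le_coth_of_le_edist` — if `Ric ≥ -(m-1) g`, `x ≠ p`, and `F` is `C²` near
  `x` with `F ≤ d(p, ·)` near `x` and `F(x) = d(p, x)` (a smooth lower support function of `r` at
  `x`), then `Δ_g F(x) ≤ (m-1) coth d(p, x)`;
* `laplaceBeltrami_le_div_of_le_edist` — if `Ric ≥ 0`, the same with `(m-1)/d(p, x)`.

THE PROOF is the second-variation argument (Lee 2018, proof of Thm. 11.15; Petersen 2016, proof
of Lemma 7.1.9), organised exactly as the tree's Bamler data (`far_end_directional_datum`,
`far_end_linear_datum`), but with the MODEL JACOBI PROFILE `sinh s / sinh T` (resp. `s/T`):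

* `exists_profile_cutoff` — a `C^∞` profile equal to a given `C^∞` function near `[0, T]` and
  vanishing off `(-1/2, T + 1/2)` (so that profile × parallel frame is a global `C^∞` field);
* `far_end_profile_datum` — along the unit speed geodesic `γ(t) = exp_p(tu)`, `T > 0`, for ANY
  such profile `φ` with `φ(0) = 0`, `φ(T) = 1`: a `g`-orthonormal frame `f` at `γ(T)` headed by
  `γ̇(T)`, the exact radial barrier `d(p, exp_{γT}(σ f none)) ≤ T + σ` (`|σ| < T`), for every
  `ε > 0` the transverse barriers `d(p, exp_{γT}(σ f o)) ≤ T + [o = none] σ + (Q o + εT)/2 · σ²`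
  for `σ` near `0` (`HaslhoferMuller.edist_toReal_le_taylor` for the fields `φ eₒ`, `eₒ` a
  parallel orthonormal frame), and the TRACE IDENTITY
  `Σₒ Q o − Q none = −∫₀ᵀ φ² Ric(γ̇, γ̇) + (m − 1) ∫₀ᵀ φ′²` (`sum_val_curvature_eq_ricci`);
* `far_end_sinh_datum`, `far_end_linear_datum'` — the profiles `sinh s/sinh T` and `s/T`:
  under `Ric ≥ -(m-1) g`, `Σₒ Q o − Q none ≤ (m-1) coth T` (since
  `∫₀ᵀ (sinh² + cosh²) = sinh T cosh T`); under `Ric ≥ 0`, `≤ (m-1)/T`;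
* the viscosity form: by Hopf–Rinow (`exists_isMinimizingUpTo_of_isGeodesicallyComplete`) `x`
  is the far end `γ(T)`, `T = d(p, x)`, of a unit speed minimizing geodesic from `p`; a `C²`
  lower support function `F` of `d(p, ·)` at `x` lies below each barrier, so
  `Hess F(f o, f o) ≤ Q o + εT` for `o ≠ none` and `Hess F(f none, f none) ≤ 0`
  (`hessian_le_of_directional_barrier`), and `Δ_g F(x) = Σₒ Hess F(f o, f o)`
  (`laplaceBeltrami_eq_sum_hessian`); let `ε → 0`.

Everything here is proved; no definitions, no named facts (D-0026). Written as groundwork for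
`CheegerColding1997_sphereStability` (Cheeger–Colding 1997, Thm. A.1.12), whose printed proof
rests on the almost-rigidity theory of Cheeger–Colding 1996, which starts from this comparison.

## References

* E. Calabi, *An extension of E. Hopf's maximum principle with an application to Riemannian
  geometry*, Duke Math. J. 25 (1958) 45–56. [Calabi1958]
* J. Cheeger, T. H. Colding, *Lower bounds on Ricci curvature and the almost rigidity of warped
  products*, Ann. of Math. 144 (1996) 189–237, §1–§2. [CheegerColding1996]
* J. Cheeger, T. H. Colding, *On the structure of spaces with Ricci curvature bounded below. I*,
  J. Differential Geom. 46 (1997) 406–480, (0.5) and Appendix 2 ("mean curvature comparison",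
  "Laplacian comparison", pp. 472–474). [CheegerColding1997]
* J. M. Lee, *Introduction to Riemannian Manifolds*, 2nd ed. (2018), Thm. 10.22 (second
  variation), Thm. 11.15 (Laplacian comparison). [LeeRiemannianManifolds2018]
* P. Petersen, *Riemannian Geometry*, 3rd ed., GTM 171 (2016), Lemma 7.1.9 and §12.
  [Petersen2016]
-/

noncomputable section

open Bundle Set Function Filter MeasureTheory intervalIntegral
open scoped Manifold ContDiff Topology ENNReal NNReal Real

namespace Literature.Geometry.Riemannian

open Lorentzian Lorentzian.PseudoRiemannianMetric


/-! ### §1 Profiles -/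

/-- **A `C^∞` profile equal to a given `C^∞` function `ψ` near `[0, T]` and vanishing off
`(−1/2, T + 1/2)`** (product of `ψ` with a smooth plateau bump built from
`Real.smoothTransition`; cf. `exists_sin_cutoff`, `exists_linear_cutoff`). [folklore] -/
theorem exists_profile_cutoff {ψ : ℝ → ℝ} (hψ : ContDiff ℝ ∞ ψ) (T : ℝ) :
    ∃ φ : ℝ → ℝ, ContDiff ℝ ∞ φ ∧
      (∀ s ∈ Ioo (-(1 / 4 : ℝ)) (T + 1 / 4), φ s = ψ s) ∧
      (∀ s, s ≤ -(1 / 2 : ℝ) → φ s = 0) ∧ (∀ s, T + 1 / 2 ≤ s → φ s = 0) := by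
  refine ⟨fun s ↦ (Real.smoothTransition (4 * s + 2) * Real.smoothTransition (4 * (T - s) + 2)) *
    ψ s, ?_, ?_, ?_, ?_⟩
  · exact ((Real.smoothTransition.contDiff.comp ((contDiff_const.mul contDiff_id).add
      contDiff_const)).mul (Real.smoothTransition.contDiff.comp
        ((contDiff_const.mul (contDiff_const.sub contDiff_id)).add contDiff_const))).mul hψ
  · intro s hs
    simp only
    rw [Real.smoothTransition.one_of_one_le (by linarith [hs.1]),
      Real.smoothTransition.one_of_one_le (by linarith [hs.2]), one_mul, one_mul]
  · intro s hs
    simp only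
    rw [Real.smoothTransition.zero_of_nonpos (by linarith), zero_mul, zero_mul]
  · intro s hs
    simp only
    rw [Real.smoothTransition.zero_of_nonpos (x := 4 * (T - s) + 2) (by linarith), mul_zero,
      zero_mul]

/-- `∫₀ᵀ (sinh² s + cosh² s) ds = sinh T cosh T` (`(sinh cosh)' = cosh² + sinh²`). [folklore] -/
theorem integral_sinh_sq_add_cosh_sq (T : ℝ) :
    ∫ s in (0 : ℝ)..T, (Real.sinh s ^ 2 + Real.cosh s ^ 2) = Real.sinh T * Real.cosh T := by
  have hd : ∀ s ∈ uIcc (0 : ℝ) T, HasDerivAt (fun s ↦ Real.sinh s * Real.cosh s)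
      (Real.sinh s ^ 2 + Real.cosh s ^ 2) s := by
    intro s _
    have h := (Real.hasDerivAt_sinh s).mul (Real.hasDerivAt_cosh s)
    exact h.congr_deriv (by ring)
  rw [intervalIntegral.integral_eq_sub_of_hasDerivAt hd
    (((Real.continuous_sinh.pow 2).add (Real.continuous_cosh.pow 2)).intervalIntegrable _ _)]
  simp

/-- The model identity behind `Δ r ≤ (m-1) coth r`: for `0 < T`,
`∫₀ᵀ ((sinh s/sinh T)² + (cosh s/sinh T)²) ds = cosh T / sinh T`. [folklore] -/
theorem integral_sinh_profile {T : ℝ} (hT : 0 < T) :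
    ∫ s in (0 : ℝ)..T, ((Real.sinh s / Real.sinh T) ^ 2 + (Real.cosh s / Real.sinh T) ^ 2) =
      Real.cosh T / Real.sinh T := by
  have hsT : Real.sinh T ≠ 0 := (Real.sinh_pos_iff.2 hT).ne'
  have h1 : (fun s ↦ (Real.sinh s / Real.sinh T) ^ 2 + (Real.cosh s / Real.sinh T) ^ 2) =
      fun s ↦ (Real.sinh T ^ 2)⁻¹ * (Real.sinh s ^ 2 + Real.cosh s ^ 2) := by
    funext s
    field_simp
  rw [h1, intervalIntegral.integral_const_mul, integral_sinh_sq_add_cosh_sq]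
  field_simp

/-- The model identity behind `Δ r ≤ (m-1)/r`: for `0 < T`,
`∫₀ᵀ (1/T)² ds = 1/T`. [folklore] -/
theorem integral_linear_profile_deriv_sq {T : ℝ} (hT : 0 < T) :
    ∫ _s in (0 : ℝ)..T, (1 / T) ^ 2 = 1 / T := by
  rw [intervalIntegral.integral_const, sub_zero, smul_eq_mul]
  field_simp


/-! ### §2 The directional datum at the far end of a unit speed geodesic, for a general profile -/

section FarEnd

variable {E : Type*} [NormedAddCommGroup E] [NormedSpace ℝ E] [FiniteDimensional ℝ E]
  [CompleteSpace E] {M : Type*} [TopologicalSpace M] [ChartedSpace E M] [IsManifold 𝓘(ℝ, E) ∞ M]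
  [T2Space M]
  (g : PseudoRiemannianMetric 𝓘(ℝ, E) ∞ E (TangentSpace 𝓘(ℝ, E) : M → Type _)) [g.HasLeviCivita]
  [CovariantDerivative.ContMDiffCovariantDerivative g.leviCivita 1]
  [CovariantDerivative.ContMDiffCovariantDerivative g.leviCivita ∞]

/-- **The directional datum at the far end of a unit speed geodesic, general profile** (second
variation of arc length in barrier form; Lee 2018, Thm. 10.22 and proof of Thm. 11.15). Let
`γ(t) = exp_p(tu)`, `|u| = 1`, `T > 0`, on a complete Riemannian manifold, and let `φ` be a
`C^∞` profile with `φ(0) = 0`, `φ(T) = 1`, vanishing off `(-1/2, T + 1/2)`. Then there are a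
`g`-orthonormal frame `f` at `γ(T)` headed by `γ̇(T)` and reals `Q o` with: the exact radial
barrier `d(p, exp_{γT}(σ f none)) ≤ T + σ` for `|σ| < T`; for every `ε > 0` the barriers
`d(p, exp_{γT}(σ f o)) ≤ T + [o = none] σ + (Q o + εT)/2 · σ²` for `σ` near `0` (the fields
`φ eₒ`, `eₒ` the parallel orthonormal frame with `eₒ(T) = f o`); and the trace identity
`Σₒ Q o − Q none = −∫₀ᵀ φ² Ric(γ̇, γ̇) + (dim M − 1) ∫₀ᵀ φ′²`.
[cite: LeeRiemannianManifolds2018, Thm. 10.22, Thm. 11.15 (proof)] -/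
theorem far_end_profile_datum (hg : g.IsRiemannian) (hc : IsGeodesicallyComplete g.leviCivita)
    (p : M) (u : TangentSpace 𝓘(ℝ, E) p) (hu : g.val p u u = 1) {T : ℝ} (hT : 0 < T)
    {φ : ℝ → ℝ} (hφs : ContDiff ℝ ∞ φ) (hφ0 : φ 0 = 0) (hφT : φ T = 1)
    (hφneg : ∀ s, s ≤ -(1 / 2 : ℝ) → φ s = 0) (hφge : ∀ s, T + 1 / 2 ≤ s → φ s = 0) :
    ∃ (k : ℕ) (f : Option (Fin k) → TangentSpace 𝓘(ℝ, E) (expMap g.leviCivita p (T • u)))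
      (Q : Option (Fin k) → ℝ),
      Fintype.card (Option (Fin k)) = Module.finrank ℝ E ∧
      (∀ o o', g.val (expMap g.leviCivita p (T • u)) (f o) (f o') = if o = o' then 1 else 0) ∧
      f none = velocity 𝓘(ℝ, E) (fun t ↦ expMap g.leviCivita p (t • u)) T ∧
      (∀ σ ∈ Ioo (-T) T, (g.edist hg p
        (expMap g.leviCivita (expMap g.leviCivita p (T • u)) (σ • f none))).toReal ≤ T + σ) ∧
      (∀ o, ∀ ε > 0, ∀ᶠ σ in 𝓝 (0 : ℝ),
        (g.edist hg p (expMap g.leviCivita (expMap g.leviCivita p (T • u)) (σ • f o))).toReal ≤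
          T + (if o = none then σ else 0) + (Q o + ε * T) / 2 * σ ^ 2) ∧
      (∑ o, Q o) - Q none =
        -(∫ s in (0 : ℝ)..T, φ s ^ 2 *
            g.leviCivita.ricci (expMap g.leviCivita p (s • u))
              (velocity 𝓘(ℝ, E) (fun t ↦ expMap g.leviCivita p (t • u)) s)
              (velocity 𝓘(ℝ, E) (fun t ↦ expMap g.leviCivita p (t • u)) s)) +
          ((Module.finrank ℝ E : ℝ) - 1) * ∫ s in (0 : ℝ)..T, deriv φ s ^ 2 := by
  classical
  have hLC := PseudoRiemannianMetric.isLeviCivita_leviCivita_holds (g := g)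
  have hreg : g.leviCivita.IsLocallyContMDiff ∞ := hLC.isLocallyContMDiff ⊤ (le_of_eq rfl)
  have hreg1 : g.leviCivita.IsLocallyContMDiff 1 :=
    hLC.isLocallyContMDiff 1 (by exact_mod_cast le_top)
  have h2 : (2 : ℕ∞ω) ≤ (∞ : ℕ∞ω) := WithTop.coe_le_coe.2 le_top
  haveI : Fact ((1 : ℕ∞ω) ≤ (∞ : ℕ∞ω)) := ⟨by exact_mod_cast le_top⟩
  -- the geodesic
  set γ : ℝ → M := fun t ↦ expMap g.leviCivita p (t • u) with hγ_def
  have hgeo : IsGeodesic g.leviCivita γ := isGeodesic_expMap_smul_of_isGeodesicallyComplete hc p u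
  have hγfun : γ = maximalGeodesic g.leviCivita p u := funext fun t ↦ expMap_smul hc p u t
  have hγs : ContMDiff 𝓘(ℝ, ℝ) 𝓘(ℝ, E) ∞ γ := by
    rw [hγfun]
    exact (contMDiff_maximalGeodesic_family hc p).comp
      (contMDiff_id.prodMk (contMDiff_const (c := (show E from u))))
  have hγd : ∀ t, MDifferentiableAt 𝓘(ℝ, ℝ) 𝓘(ℝ, E) γ t := fun t ↦
    mdifferentiableAt_of_mdifferentiableAt_lift (hgeo.1 t (mem_univ t))
  have hγc : ∀ t, ContinuousAt (tangentLift 𝓘(ℝ, E) γ) t := fun t ↦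
    (hgeo.1 t (mem_univ t)).continuousAt
  have hγ0 : γ 0 = p := by
    show expMap g.leviCivita p ((0 : ℝ) • u) = p
    rw [zero_smul]; exact expMap_zero (cov := g.leviCivita) p
  have hspeed : ∀ t, g.val (γ t) (velocity 𝓘(ℝ, E) γ t) (velocity 𝓘(ℝ, E) γ t) = 1 := by
    intro t
    have h := g.val_velocity_eq_of_isGeodesicOn_holds isOpen_univ ordConnected_univ hgeo
      (mem_univ t) (mem_univ 0)
    have hv0 : (velocity 𝓘(ℝ, E) γ 0 : E) = (u : E) := velocity_expMap_smul_zero p u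
    rw [h, hv0, hγ0, hu]
  -- the frame at `γ T` headed by `γ̇ T`, transported along `γ` on `(-1, T + 1)`
  obtain ⟨k, f₀, hf₀none, hf₀on, hcard⟩ := exists_orthonormal_frame_with_head g hg (γ T) (hspeed T)
  have hT₀ : T ∈ Ioo (-1 : ℝ) (T + 1) := ⟨by linarith, by linarith⟩
  obtain ⟨e, he0, hepar, heon⟩ :=
    exists_parallel_orthonormal_frame_Ioo' g hg hLC.2 hreg hγd hγc hT₀ f₀ hf₀on
  have helift : ∀ o, ∀ t ∈ Ioo (-1 : ℝ) (T + 1), ContMDiffAt 𝓘(ℝ, ℝ) 𝓘(ℝ, E).tangent ∞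
      (fun t ↦ (TotalSpace.mk' E (γ t) (e o t) : TangentBundle 𝓘(ℝ, E) M)) t := fun o t ht ↦
    HaslhoferMuller.contMDiffAt_lift_of_isParallelAlongOn g.leviCivita hreg hγs isOpen_Ioo
      (hepar o) ht
  -- the head of the frame is the velocity (both are parallel and agree at `T`)
  have hhead : ∀ t ∈ Ioo (-1 : ℝ) (T + 1), e none t = velocity 𝓘(ℝ, E) γ t := by
    intro t ht
    have hvelpar : IsParallelAlongOn g.leviCivita γ (fun t ↦ velocity 𝓘(ℝ, E) γ t)
        (Ioo (-1 : ℝ) (T + 1)) :=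
      (IsGeodesicOn.isParallelAlongOn_velocity (hgeo.isGeodesicOn univ)).mono (subset_univ _)
    exact eq_of_isParallelAlongOn g hg hLC.2 ordConnected_Ioo (hepar none) hvelpar hT₀
      ((he0 none).trans hf₀none) ht
  -- the variation fields `X_o = φ • e_o`
  set X : Option (Fin k) → Π t : ℝ, TangentSpace 𝓘(ℝ, E) (γ t) := fun o t ↦ φ t • e o t
    with hX_def
  have hzeroLift : ContMDiff 𝓘(ℝ, ℝ) 𝓘(ℝ, E).tangent ∞
      (fun t ↦ (TotalSpace.mk' E (γ t) (0 : TangentSpace 𝓘(ℝ, E) (γ t)) :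
        TangentBundle 𝓘(ℝ, E) M)) :=
    (contMDiff_zeroSection ℝ (TangentSpace 𝓘(ℝ, E) : M → Type _)).comp hγs
  have hXs : ∀ o, ContMDiff 𝓘(ℝ, ℝ) 𝓘(ℝ, E).tangent ∞
      (fun t ↦ (TotalSpace.mk' E (γ t) (X o t) : TangentBundle 𝓘(ℝ, E) M)) := by
    intro o t
    by_cases ht : t ∈ Ioo (-1 : ℝ) (T + 1)
    · exact contMDiffAt_liftAlong_smul (helift o t ht) (hφs.contDiffAt.contMDiffAt)
    · refine (hzeroLift t).congr_of_eventuallyEq ?_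
      rcases le_or_gt t (-1) with hle | hgt
      · filter_upwards [(isOpen_gt' (-(1 / 2) : ℝ)).mem_nhds (show t < -(1 / 2) by linarith)]
          with s hs
        show (TotalSpace.mk' E (γ s) (X o s) : TangentBundle 𝓘(ℝ, E) M) =
          TotalSpace.mk' E (γ s) (0 : TangentSpace 𝓘(ℝ, E) (γ s))
        rw [hX_def]
        simp only [hφneg s (le_of_lt hs), zero_smul]
      · have hge : T + 1 ≤ t := by
          by_contra hlt
          exact ht ⟨hgt, lt_of_not_ge hlt⟩
        filter_upwards [(isOpen_lt' (T + 1 / 2)).mem_nhds (show T + 1 / 2 < t by linarith)]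
          with s hs
        show (TotalSpace.mk' E (γ s) (X o s) : TangentBundle 𝓘(ℝ, E) M) =
          TotalSpace.mk' E (γ s) (0 : TangentSpace 𝓘(ℝ, E) (γ s))
        rw [hX_def]
        simp only [hφge s (le_of_lt hs), zero_smul]
  have hX0 : ∀ o, X o 0 = 0 := fun o ↦ by
    show φ 0 • e o 0 = 0
    rw [hφ0, zero_smul]
  have hXT : ∀ o, X o T = f₀ o := fun o ↦ by
    show φ T • e o T = f₀ o
    rw [hφT, one_smul, he0]
  -- the index integrands and their integrals
  set qf : Option (Fin k) → ℝ → ℝ := fun o t ↦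
    g.val (γ t) (g.leviCivita.curvature (γ t) (X o t) (velocity 𝓘(ℝ, E) γ t) (X o t))
        (velocity 𝓘(ℝ, E) γ t) +
      g.val (γ t) (covariantDerivAlong g.leviCivita γ (X o) t)
        (covariantDerivAlong g.leviCivita γ (X o) t) with hqf_def
  have hqfc : ∀ o, Continuous (qf o) := fun o ↦
    (integral_energy_le_taylor g le_rfl hc (hXs o) hT.le).1
  set Q : Option (Fin k) → ℝ := fun o ↦ ∫ t in (0 : ℝ)..T, qf o t with hQ_def
  -- the Taylor barriers (every direction, every `ε`)
  have hbar : ∀ o, ∀ ε > 0, ∀ᶠ σ in 𝓝 (0 : ℝ),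
      (g.edist hg p (expMap g.leviCivita (expMap g.leviCivita p (T • u)) (σ • f₀ o))).toReal ≤
        T + (if o = none then σ else 0) + (Q o + ε * T) / 2 * σ ^ 2 := by
    intro o ε hε
    obtain ⟨δ, hδ, hδ'⟩ :=
      HaslhoferMuller.edist_toReal_le_taylor g le_rfl hg hc p u hu (hXs o) (hX0 o) hT ε hε
    filter_upwards [Icc_mem_nhds (show -δ < 0 by linarith) hδ] with σ hσ
    have h := hδ' σ hσ
    have ha : g.val (expMap g.leviCivita p (T • u)) (f₀ o)
        (velocity 𝓘(ℝ, E) (fun t ↦ expMap g.leviCivita p (t • u)) T) =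
        if o = none then 1 else 0 := by
      show g.val (γ T) (f₀ o) (velocity 𝓘(ℝ, E) γ T) = _
      rw [← hf₀none, hf₀on]
    rw [hXT] at h
    rw [ha] at h
    have hif : σ * (if o = none then (1 : ℝ) else 0) = if o = none then σ else 0 := by
      split_ifs <;> simp
    calc (g.edist hg p (expMap g.leviCivita (expMap g.leviCivita p (T • u)) (σ • f₀ o))).toReal
        ≤ T + σ * (if o = none then (1 : ℝ) else 0) + σ ^ 2 * ((Q o) + ε * T) / 2 := h
      _ = T + (if o = none then σ else 0) + (Q o + ε * T) / 2 * σ ^ 2 := by rw [hif]; ring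
  -- the exact radial barrier
  have hrad : ∀ σ ∈ Ioo (-T) T, (g.edist hg p
      (expMap g.leviCivita (expMap g.leviCivita p (T • u)) (σ • f₀ none))).toReal ≤ T + σ := by
    intro σ hσ
    rw [hf₀none, expMap_smul_velocity_eq g hc p u T σ]
    have h1 := (edist_toReal_le_of_unit_speed g hg hγs (T' := T + σ) (by linarith [hσ.1])
      hspeed).2
    rwa [hγ0] at h1
  -- (A) the index integrand of `X_o` in the frame, on the interval
  have hφd : ∀ t, DifferentiableAt ℝ φ t := fun t ↦
    (hφs.differentiable (by simp)).differentiableAt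
  have hqf : ∀ o, ∀ t ∈ Ioo (-1 : ℝ) (T + 1), qf o t =
      -(φ t ^ 2 * g.val (γ t) (g.leviCivita.curvature (γ t) (e o t) (velocity 𝓘(ℝ, E) γ t)
        (velocity 𝓘(ℝ, E) γ t)) (e o t)) + deriv φ t ^ 2 := by
    intro o t ht
    have hD : covariantDerivAlong g.leviCivita γ (X o) t = deriv φ t • e o t := by
      have h := covariantDerivAlong_smul_holds g.leviCivita (γ := γ) (W := e o) (f := φ) (t₀ := t)
        (hφd t) (hepar o t ht).1
      rw [(hepar o t ht).2, smul_zero, add_zero] at h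
      exact h
    have hcurv : g.val (γ t) (g.leviCivita.curvature (γ t) (X o t) (velocity 𝓘(ℝ, E) γ t) (X o t))
        (velocity 𝓘(ℝ, E) γ t) = φ t ^ 2 * g.val (γ t) (g.leviCivita.curvature (γ t) (e o t)
          (velocity 𝓘(ℝ, E) γ t) (e o t)) (velocity 𝓘(ℝ, E) γ t) := by
      show g.val (γ t) (g.leviCivita.curvature (γ t) (φ t • e o t) (velocity 𝓘(ℝ, E) γ t)
        (φ t • e o t)) (velocity 𝓘(ℝ, E) γ t) = _
      simp only [map_smul, FunLike.coe_smul, Pi.smul_apply, smul_eq_mul]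
      ring
    have hskew := hLC.val_curvature_skew h2 (γ t) (e o t) (velocity 𝓘(ℝ, E) γ t) (e o t)
      (velocity 𝓘(ℝ, E) γ t)
    have hDD : g.val (γ t) (covariantDerivAlong g.leviCivita γ (X o) t)
        (covariantDerivAlong g.leviCivita γ (X o) t) = deriv φ t ^ 2 := by
      rw [hD]
      simp only [map_smul, FunLike.coe_smul, Pi.smul_apply, smul_eq_mul]
      rw [heon t ht o o, if_pos rfl]
      ring
    show g.val (γ t) (g.leviCivita.curvature (γ t) (X o t) (velocity 𝓘(ℝ, E) γ t) (X o t))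
        (velocity 𝓘(ℝ, E) γ t) + g.val (γ t) (covariantDerivAlong g.leviCivita γ (X o) t)
        (covariantDerivAlong g.leviCivita γ (X o) t) = _
    rw [hcurv, hDD, hskew]
    ring
  -- the radial curvature term vanishes (`e none = γ̇`)
  have hqfnone : ∀ t ∈ Ioo (-1 : ℝ) (T + 1), qf none t = deriv φ t ^ 2 := by
    intro t ht
    rw [hqf none t ht, hhead t ht,
      val_curvature_self_eq_zero hLC.2 hreg1 h2 (γ t) (velocity 𝓘(ℝ, E) γ t) (velocity 𝓘(ℝ, E) γ t)
        (velocity 𝓘(ℝ, E) γ t)]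
    ring
  -- (B) summing over the frame: `Σ_o q_o = −φ² Ric(γ̇,γ̇) + card · φ'²`
  have hsum : ∀ t ∈ Ioo (-1 : ℝ) (T + 1), ∑ o, qf o t =
      -(φ t ^ 2 * g.leviCivita.ricci (γ t) (velocity 𝓘(ℝ, E) γ t) (velocity 𝓘(ℝ, E) γ t)) +
        (Fintype.card (Option (Fin k)) : ℝ) * deriv φ t ^ 2 := by
    intro t ht
    have hric := sum_val_curvature_eq_ricci g g.leviCivita (γ t) (heon t ht) hcard
      (velocity 𝓘(ℝ, E) γ t)
    rw [Finset.sum_congr rfl fun o _ ↦ hqf o t ht, Finset.sum_add_distrib, Finset.sum_const,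
      Finset.card_univ, nsmul_eq_mul, Finset.sum_neg_distrib, ← Finset.mul_sum, hric]
  -- (C) the integrals
  have hIoo : uIcc (0 : ℝ) T ⊆ Ioo (-1 : ℝ) (T + 1) := by
    rw [uIcc_of_le hT.le]
    exact fun t ht ↦ ⟨by linarith [ht.1], by linarith [ht.2]⟩
  have hric_c : Continuous fun t ↦ g.leviCivita.ricci (γ t) (velocity 𝓘(ℝ, E) γ t)
      (velocity 𝓘(ℝ, E) γ t) := by
    have hTl := contMDiff_lift_velocity_of_contMDiff (I := 𝓘(ℝ, E)) hγs
    exact (show ContMDiff 𝓘(ℝ, ℝ) 𝓘(ℝ, ℝ) ∞ _ from fun t ↦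
      contMDiffAt_ricci_apply_along g (hTl t) (hTl t)).continuous
  have hsumQ : ∑ o, Q o = -(∫ t in (0 : ℝ)..T, φ t ^ 2 *
      g.leviCivita.ricci (γ t) (velocity 𝓘(ℝ, E) γ t) (velocity 𝓘(ℝ, E) γ t)) +
      (Fintype.card (Option (Fin k)) : ℝ) * ∫ t in (0 : ℝ)..T, deriv φ t ^ 2 := by
    have h1 : ∑ o, Q o = ∫ t in (0 : ℝ)..T, ∑ o, qf o t := by
      rw [intervalIntegral.integral_finsetSum]
      exact fun o _ ↦ (hqfc o).intervalIntegrable _ _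
    rw [h1, intervalIntegral.integral_congr fun t ht ↦ hsum t (hIoo ht)]
    have hI1 : IntervalIntegrable (fun t ↦ -(φ t ^ 2 *
        g.leviCivita.ricci (γ t) (velocity 𝓘(ℝ, E) γ t) (velocity 𝓘(ℝ, E) γ t))) volume 0 T :=
      ((hφs.continuous.pow 2).mul hric_c).neg.intervalIntegrable _ _
    have hI2 : IntervalIntegrable (fun t ↦ (Fintype.card (Option (Fin k)) : ℝ) * deriv φ t ^ 2)
        volume 0 T :=
      (continuous_const.mul ((hφs.continuous_deriv (by simp)).pow 2)).intervalIntegrable _ _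
    rw [intervalIntegral.integral_add hI1 hI2, intervalIntegral.integral_neg,
      intervalIntegral.integral_const_mul]
  have hQnone : Q none = ∫ t in (0 : ℝ)..T, deriv φ t ^ 2 := by
    show ∫ t in (0 : ℝ)..T, qf none t = _
    rw [intervalIntegral.integral_congr fun t ht ↦ hqfnone t (hIoo ht)]
  -- (D) assembly
  refine ⟨k, f₀, Q, hcard, hf₀on, hf₀none, hrad, hbar, ?_⟩
  have hcardR : (Fintype.card (Option (Fin k)) : ℝ) = (Module.finrank ℝ E : ℝ) := by
    exact_mod_cast hcard
  rw [hsumQ, hQnone, hcardR]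
  ring

end FarEnd


/-! ### §3 The model profiles under a Ricci lower bound -/

section Models

variable {E : Type*} [NormedAddCommGroup E] [NormedSpace ℝ E] [FiniteDimensional ℝ E]
  [CompleteSpace E] {M : Type*} [TopologicalSpace M] [ChartedSpace E M] [IsManifold 𝓘(ℝ, E) ∞ M]
  [T2Space M]
  (g : PseudoRiemannianMetric 𝓘(ℝ, E) ∞ E (TangentSpace 𝓘(ℝ, E) : M → Type _)) [g.HasLeviCivita]
  [CovariantDerivative.ContMDiffCovariantDerivative g.leviCivita 1]
  [CovariantDerivative.ContMDiffCovariantDerivative g.leviCivita ∞]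

/-- The radial geodesic `γ(t) = exp_p(tu)` of a complete connection with `|u|_g = 1` is `C^∞`
and has unit speed, and `t ↦ Ric(γ̇(t), γ̇(t))` is continuous. [folklore] -/
theorem unit_speed_expMap_smul (hg : g.IsRiemannian) (hc : IsGeodesicallyComplete g.leviCivita)
    (p : M) (u : TangentSpace 𝓘(ℝ, E) p) (hu : g.val p u u = 1) :
    ContMDiff 𝓘(ℝ, ℝ) 𝓘(ℝ, E) ∞ (fun t : ℝ ↦ expMap g.leviCivita p (t • u)) ∧
    (∀ t : ℝ, g.val (expMap g.leviCivita p (t • u))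
      (velocity 𝓘(ℝ, E) (fun t : ℝ ↦ expMap g.leviCivita p (t • u)) t)
      (velocity 𝓘(ℝ, E) (fun t : ℝ ↦ expMap g.leviCivita p (t • u)) t) = 1) ∧
    Continuous fun t : ℝ ↦ g.leviCivita.ricci (expMap g.leviCivita p (t • u))
      (velocity 𝓘(ℝ, E) (fun t : ℝ ↦ expMap g.leviCivita p (t • u)) t)
      (velocity 𝓘(ℝ, E) (fun t : ℝ ↦ expMap g.leviCivita p (t • u)) t) := by
  have _ := hg
  set γ : ℝ → M := fun t ↦ expMap g.leviCivita p (t • u) with hγ_def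
  have hgeo : IsGeodesic g.leviCivita γ := isGeodesic_expMap_smul_of_isGeodesicallyComplete hc p u
  have hγfun : γ = maximalGeodesic g.leviCivita p u := funext fun t ↦ expMap_smul hc p u t
  have hγs : ContMDiff 𝓘(ℝ, ℝ) 𝓘(ℝ, E) ∞ γ := by
    rw [hγfun]
    exact (contMDiff_maximalGeodesic_family hc p).comp
      (contMDiff_id.prodMk (contMDiff_const (c := (show E from u))))
  have hγ0 : γ 0 = p := by
    show expMap g.leviCivita p ((0 : ℝ) • u) = p
    rw [zero_smul]; exact expMap_zero (cov := g.leviCivita) p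
  have hspeed : ∀ t, g.val (γ t) (velocity 𝓘(ℝ, E) γ t) (velocity 𝓘(ℝ, E) γ t) = 1 := by
    intro t
    have h := g.val_velocity_eq_of_isGeodesicOn_holds isOpen_univ ordConnected_univ hgeo
      (mem_univ t) (mem_univ 0)
    have hv0 : (velocity 𝓘(ℝ, E) γ 0 : E) = (u : E) := velocity_expMap_smul_zero p u
    rw [h, hv0, hγ0, hu]
  refine ⟨hγs, hspeed, ?_⟩
  have hTl := contMDiff_lift_velocity_of_contMDiff (I := 𝓘(ℝ, E)) hγs
  exact (show ContMDiff 𝓘(ℝ, ℝ) 𝓘(ℝ, ℝ) ∞ _ from fun t ↦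
    contMDiffAt_ricci_apply_along g (hTl t) (hTl t)).continuous

/-- **The far-end datum under `Ric ≥ κ g`, general profile**: as in `far_end_profile_datum`,
with the trace identity replaced by the bound
`Σₒ Q o − Q none ≤ −κ ∫₀ᵀ φ² + (dim M − 1) ∫₀ᵀ φ′²` (`Ric(γ̇, γ̇) ≥ κ` along the unit speed
geodesic). [cite: LeeRiemannianManifolds2018, Thm. 11.15 (proof)] -/
theorem far_end_profile_datum_of_ricci_ge (hg : g.IsRiemannian)
    (hc : IsGeodesicallyComplete g.leviCivita) {κ : ℝ}
    (hRic : ∀ (x : M) (w : TangentSpace 𝓘(ℝ, E) x), κ * g.val x w w ≤ g.leviCivita.ricci x w w)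
    (p : M) (u : TangentSpace 𝓘(ℝ, E) p) (hu : g.val p u u = 1) {T : ℝ} (hT : 0 < T)
    {φ : ℝ → ℝ} (hφs : ContDiff ℝ ∞ φ) (hφ0 : φ 0 = 0) (hφT : φ T = 1)
    (hφneg : ∀ s, s ≤ -(1 / 2 : ℝ) → φ s = 0) (hφge : ∀ s, T + 1 / 2 ≤ s → φ s = 0) :
    ∃ (k : ℕ) (f : Option (Fin k) → TangentSpace 𝓘(ℝ, E) (expMap g.leviCivita p (T • u)))
      (Q : Option (Fin k) → ℝ),
      Fintype.card (Option (Fin k)) = Module.finrank ℝ E ∧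
      (∀ o o', g.val (expMap g.leviCivita p (T • u)) (f o) (f o') = if o = o' then 1 else 0) ∧
      f none = velocity 𝓘(ℝ, E) (fun t ↦ expMap g.leviCivita p (t • u)) T ∧
      (∀ σ ∈ Ioo (-T) T, (g.edist hg p
        (expMap g.leviCivita (expMap g.leviCivita p (T • u)) (σ • f none))).toReal ≤ T + σ) ∧
      (∀ o, ∀ ε > 0, ∀ᶠ σ in 𝓝 (0 : ℝ),
        (g.edist hg p (expMap g.leviCivita (expMap g.leviCivita p (T • u)) (σ • f o))).toReal ≤
          T + (if o = none then σ else 0) + (Q o + ε * T) / 2 * σ ^ 2) ∧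
      (∑ o, Q o) - Q none ≤
        -κ * (∫ s in (0 : ℝ)..T, φ s ^ 2) +
          ((Module.finrank ℝ E : ℝ) - 1) * ∫ s in (0 : ℝ)..T, deriv φ s ^ 2 := by
  obtain ⟨k, f, Q, hcard, hon, hhead, hrad, hbar, htrace⟩ :=
    far_end_profile_datum g hg hc p u hu hT hφs hφ0 hφT hφneg hφge
  refine ⟨k, f, Q, hcard, hon, hhead, hrad, hbar, ?_⟩
  obtain ⟨-, hspeed, hric_c⟩ := unit_speed_expMap_smul g hg hc p u hu
  rw [htrace]
  refine add_le_add ?_ le_rfl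
  rw [neg_mul, neg_le_neg_iff, ← intervalIntegral.integral_const_mul]
  refine intervalIntegral.integral_mono_on hT.le ?_ ?_ fun t _ ↦ ?_
  · exact (continuous_const.mul (hφs.continuous.pow 2)).intervalIntegrable _ _
  · exact ((hφs.continuous.pow 2).mul hric_c).intervalIntegrable _ _
  · have h := hRic _ (velocity 𝓘(ℝ, E) (fun t ↦ expMap g.leviCivita p (t • u)) t)
    rw [hspeed t, mul_one] at h
    rw [mul_comm]
    exact mul_le_mul_of_nonneg_left h (sq_nonneg _)

/-- **Laplacian comparison datum, hyperbolic model** (`Ric ≥ -(m-1) g`, profile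
`sinh s / sinh T`): at the far end `γ(T)`, `T > 0`, of a unit speed geodesic from `p` there are a
`g`-orthonormal frame `f` headed by `γ̇(T)` and reals `Q o` with the radial barrier
`d(p, exp(σ f none)) ≤ T + σ` (`|σ| < T`), the transverse barriers
`d(p, exp(σ f o)) ≤ T + [o = none] σ + (Q o + εT)/2 · σ²` (`σ` near `0`, every `ε > 0`), and
  `Σ_{o ≠ none} Q o ≤ (m − 1) coth T`
— "`Δ r ≤ (m-1) coth r` in the barrier sense" (Calabi). [cite: LeeRiemannianManifolds2018,
Thm. 11.15] [cite: CheegerColding1996, §1] -/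
theorem far_end_sinh_datum (hg : g.IsRiemannian) (hc : IsGeodesicallyComplete g.leviCivita)
    (hRic : ∀ (x : M) (w : TangentSpace 𝓘(ℝ, E) x),
      -((Module.finrank ℝ E : ℝ) - 1) * g.val x w w ≤ g.leviCivita.ricci x w w)
    (p : M) (u : TangentSpace 𝓘(ℝ, E) p) (hu : g.val p u u = 1) {T : ℝ} (hT : 0 < T) :
    ∃ (k : ℕ) (f : Option (Fin k) → TangentSpace 𝓘(ℝ, E) (expMap g.leviCivita p (T • u)))
      (Q : Option (Fin k) → ℝ),
      Fintype.card (Option (Fin k)) = Module.finrank ℝ E ∧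
      (∀ o o', g.val (expMap g.leviCivita p (T • u)) (f o) (f o') = if o = o' then 1 else 0) ∧
      f none = velocity 𝓘(ℝ, E) (fun t ↦ expMap g.leviCivita p (t • u)) T ∧
      (∀ σ ∈ Ioo (-T) T, (g.edist hg p
        (expMap g.leviCivita (expMap g.leviCivita p (T • u)) (σ • f none))).toReal ≤ T + σ) ∧
      (∀ o, ∀ ε > 0, ∀ᶠ σ in 𝓝 (0 : ℝ),
        (g.edist hg p (expMap g.leviCivita (expMap g.leviCivita p (T • u)) (σ • f o))).toReal ≤
          T + (if o = none then σ else 0) + (Q o + ε * T) / 2 * σ ^ 2) ∧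
      (∑ o, Q o) - Q none ≤ ((Module.finrank ℝ E : ℝ) - 1) * (Real.cosh T / Real.sinh T) := by
  have hsT : Real.sinh T ≠ 0 := (Real.sinh_pos_iff.2 hT).ne'
  obtain ⟨φ, hφs, hφeq, hφneg, hφge⟩ :=
    exists_profile_cutoff (Real.contDiff_sinh.div_const (Real.sinh T)) T
  have hφ0 : φ 0 = 0 := by
    rw [hφeq 0 ⟨by norm_num, by linarith⟩]; simp
  have hφT : φ T = 1 := by
    rw [hφeq T ⟨by linarith, by linarith⟩]; exact div_self hsT
  obtain ⟨k, f, Q, hcard, hon, hhead, hrad, hbar, hle⟩ :=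
    far_end_profile_datum_of_ricci_ge g hg hc hRic p u hu hT hφs hφ0 hφT hφneg hφge
  refine ⟨k, f, Q, hcard, hon, hhead, hrad, hbar, hle.trans ?_⟩
  -- `1 ≤ dim M`
  have hm1 : (0 : ℝ) ≤ (Module.finrank ℝ E : ℝ) - 1 := by
    have h1 : 1 ≤ Module.finrank ℝ E := by
      rw [← hcard, Fintype.card_option]
      exact Nat.le_add_left 1 _
    have h2 : (1 : ℝ) ≤ (Module.finrank ℝ E : ℝ) := by exact_mod_cast h1
    linarith
  have hIcc' : uIcc (0 : ℝ) T ⊆ Ioo (-(1 / 4) : ℝ) (T + 1 / 4) := by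
    rw [uIcc_of_le hT.le]
    exact fun t ht ↦ ⟨by linarith [ht.1], by linarith [ht.2]⟩
  have hφ' : ∀ t ∈ Ioo (-(1 / 4) : ℝ) (T + 1 / 4), deriv φ t = Real.cosh t / Real.sinh T := by
    intro t ht
    have hev : φ =ᶠ[𝓝 t] fun s ↦ Real.sinh s / Real.sinh T :=
      eventuallyEq_of_mem (isOpen_Ioo.mem_nhds ht) fun s hs ↦ hφeq s hs
    rw [hev.deriv_eq]
    exact ((Real.hasDerivAt_sinh t).div_const (Real.sinh T)).deriv
  have hI1 : ∫ s in (0 : ℝ)..T, φ s ^ 2 = ∫ s in (0 : ℝ)..T, (Real.sinh s / Real.sinh T) ^ 2 :=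
    intervalIntegral.integral_congr fun t ht ↦ by
      show φ t ^ 2 = (Real.sinh t / Real.sinh T) ^ 2
      rw [hφeq t (hIcc' ht)]
  have hI2 : ∫ s in (0 : ℝ)..T, deriv φ s ^ 2 =
      ∫ s in (0 : ℝ)..T, (Real.cosh s / Real.sinh T) ^ 2 :=
    intervalIntegral.integral_congr fun t ht ↦ by
      show deriv φ t ^ 2 = (Real.cosh t / Real.sinh T) ^ 2
      rw [hφ' t (hIcc' ht)]
  have hsum : (∫ s in (0 : ℝ)..T, (Real.sinh s / Real.sinh T) ^ 2) +
      (∫ s in (0 : ℝ)..T, (Real.cosh s / Real.sinh T) ^ 2) = Real.cosh T / Real.sinh T := by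
    rw [← intervalIntegral.integral_add, integral_sinh_profile hT]
    · exact ((Real.continuous_sinh.div_const _).pow 2).intervalIntegrable _ _
    · exact ((Real.continuous_cosh.div_const _).pow 2).intervalIntegrable _ _
  rw [hI1, hI2, neg_neg, ← hsum, mul_add]

/-- **Laplacian comparison datum, Euclidean model** (`Ric ≥ 0`, profile `s/T`): as in
`far_end_sinh_datum` with `Σ_{o ≠ none} Q o ≤ (m − 1)/T` — "`Δ r ≤ (m-1)/r` in the barrier
sense" (Calabi 1958). [cite: LeeRiemannianManifolds2018, Thm. 11.15] [cite: Calabi1958] -/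
theorem far_end_linear_datum_of_ricci_nonneg (hg : g.IsRiemannian)
    (hc : IsGeodesicallyComplete g.leviCivita)
    (hRic : ∀ (x : M) (w : TangentSpace 𝓘(ℝ, E) x), 0 ≤ g.leviCivita.ricci x w w)
    (p : M) (u : TangentSpace 𝓘(ℝ, E) p) (hu : g.val p u u = 1) {T : ℝ} (hT : 0 < T) :
    ∃ (k : ℕ) (f : Option (Fin k) → TangentSpace 𝓘(ℝ, E) (expMap g.leviCivita p (T • u)))
      (Q : Option (Fin k) → ℝ),
      Fintype.card (Option (Fin k)) = Module.finrank ℝ E ∧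
      (∀ o o', g.val (expMap g.leviCivita p (T • u)) (f o) (f o') = if o = o' then 1 else 0) ∧
      f none = velocity 𝓘(ℝ, E) (fun t ↦ expMap g.leviCivita p (t • u)) T ∧
      (∀ σ ∈ Ioo (-T) T, (g.edist hg p
        (expMap g.leviCivita (expMap g.leviCivita p (T • u)) (σ • f none))).toReal ≤ T + σ) ∧
      (∀ o, ∀ ε > 0, ∀ᶠ σ in 𝓝 (0 : ℝ),
        (g.edist hg p (expMap g.leviCivita (expMap g.leviCivita p (T • u)) (σ • f o))).toReal ≤
          T + (if o = none then σ else 0) + (Q o + ε * T) / 2 * σ ^ 2) ∧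
      (∑ o, Q o) - Q none ≤ ((Module.finrank ℝ E : ℝ) - 1) * (1 / T) := by
  obtain ⟨φ, hφs, hφeq, hφneg, hφge⟩ :=
    exists_profile_cutoff (contDiff_id.div_const T : ContDiff ℝ ∞ fun s : ℝ ↦ s / T) T
  have hφ0 : φ 0 = 0 := by
    rw [hφeq 0 ⟨by norm_num, by linarith⟩]; simp
  have hφT : φ T = 1 := by
    rw [hφeq T ⟨by linarith, by linarith⟩]; exact div_self hT.ne'
  have hRic' : ∀ (x : M) (w : TangentSpace 𝓘(ℝ, E) x),
      (0 : ℝ) * g.val x w w ≤ g.leviCivita.ricci x w w := fun x w ↦ by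
    rw [zero_mul]; exact hRic x w
  obtain ⟨k, f, Q, hcard, hon, hhead, hrad, hbar, hle⟩ :=
    far_end_profile_datum_of_ricci_ge g hg hc hRic' p u hu hT hφs hφ0 hφT hφneg hφge
  refine ⟨k, f, Q, hcard, hon, hhead, hrad, hbar, hle.trans ?_⟩
  have hIcc' : uIcc (0 : ℝ) T ⊆ Ioo (-(1 / 4) : ℝ) (T + 1 / 4) := by
    rw [uIcc_of_le hT.le]
    exact fun t ht ↦ ⟨by linarith [ht.1], by linarith [ht.2]⟩
  have hφ' : ∀ t ∈ Ioo (-(1 / 4) : ℝ) (T + 1 / 4), deriv φ t = 1 / T := by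
    intro t ht
    have hev : φ =ᶠ[𝓝 t] fun s ↦ s / T :=
      eventuallyEq_of_mem (isOpen_Ioo.mem_nhds ht) fun s hs ↦ hφeq s hs
    rw [hev.deriv_eq]
    have hd : HasDerivAt (fun s : ℝ ↦ s / T) (1 / T) t := (hasDerivAt_id t).div_const T
    exact hd.deriv
  have hI2 : ∫ s in (0 : ℝ)..T, deriv φ s ^ 2 = ∫ _s in (0 : ℝ)..T, (1 / T) ^ 2 :=
    intervalIntegral.integral_congr fun t ht ↦ by
      show deriv φ t ^ 2 = (1 / T) ^ 2
      rw [hφ' t (hIcc' ht)]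
  rw [neg_zero, zero_mul, zero_add, hI2, integral_linear_profile_deriv_sq hT]

end Models


/-! ### §4 Laplacian comparison in the viscosity (barrier) sense -/

section Viscosity

variable {E : Type*} [NormedAddCommGroup E] [NormedSpace ℝ E] [FiniteDimensional ℝ E]
  [CompleteSpace E] {M : Type*} [TopologicalSpace M] [ChartedSpace E M] [IsManifold 𝓘(ℝ, E) ∞ M]
  [T2Space M]
  (g : PseudoRiemannianMetric 𝓘(ℝ, E) ∞ E (TangentSpace 𝓘(ℝ, E) : M → Type _)) [g.HasLeviCivita]
  [CovariantDerivative.ContMDiffCovariantDerivative g.leviCivita 1]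
  [CovariantDerivative.ContMDiffCovariantDerivative g.leviCivita ∞]

omit [CovariantDerivative.ContMDiffCovariantDerivative g.leviCivita ∞] in
/-- **Hopf–Rinow, unit speed form**: on a connected complete Riemannian manifold every `x ≠ p`
is the far end `x = exp_p(T u)` of a unit speed (`|u|_g = 1`) geodesic from `p` of length
`T = d(p, x) > 0`, i.e. a minimizing one (`exists_isMinimizingUpTo_of_isGeodesicallyComplete`,
reparametrised). [cite: LeeRiemannianManifolds2018, Cor. 6.21] -/
theorem exists_unit_speed_expMap_eq_of_ne [ConnectedSpace M] (hg : g.IsRiemannian)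
    (hc : IsGeodesicallyComplete g.leviCivita) {p x : M} (hxp : x ≠ p) :
    ∃ (u : TangentSpace 𝓘(ℝ, E) p) (T : ℝ), g.val p u u = 1 ∧ 0 < T ∧
      T = (g.edist hg p x).toReal ∧ expMap g.leviCivita p (T • u) = x := by
  haveI : LocallyCompactSpace M := Manifold.locallyCompact_of_finiteDimensional 𝓘(ℝ, E)
  haveI : RegularSpace M := inferInstance
  obtain ⟨v, hmin, hq⟩ := exists_isMinimizingUpTo_of_isGeodesicallyComplete g le_rfl hg hc p x
  have h1 : x = maximalGeodesic g.leviCivita p v 1 := by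
    rw [← hq]; exact expMap_eq_maximalGeodesic hc p v
  have hdist : g.edist hg p x = ENNReal.ofReal (Real.sqrt (g.val p v v)) := by
    rw [h1, ← hmin.2, length_maximalGeodesic hg hc p v 0 1, sub_zero, one_mul]
  obtain ⟨T, hT⟩ : ∃ T : ℝ, T = (g.edist hg p x).toReal := ⟨_, rfl⟩
  have hTℓ : T = Real.sqrt (g.val p v v) := by
    rw [hT, hdist, ENNReal.toReal_ofReal (Real.sqrt_nonneg _)]
  have hTpos : 0 < T := by
    rw [hT]
    refine ENNReal.toReal_pos (fun h0 ↦ hxp ?_) (edist_ne_top hg p x)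
    exact ((edist_eq_zero_iff hg).1 h0).symm
  have hvv0 : 0 ≤ g.val p v v := by
    by_cases hv : v = 0
    · simp [hv]
    · exact (hg p v hv).le
  have hvv : g.val p v v = T ^ 2 := by rw [hTℓ, Real.sq_sqrt hvv0]
  refine ⟨T⁻¹ • v, T, ?_, hTpos, hT, ?_⟩
  · have h2 : g.val p (T⁻¹ • v) (T⁻¹ • v) = T⁻¹ * T⁻¹ * g.val p v v := by
      simp only [map_smul, FunLike.coe_smul, Pi.smul_apply, smul_eq_mul]
      ring
    rw [h2, hvv]
    field_simp
  · rw [smul_smul, mul_inv_cancel₀ hTpos.ne', one_smul, ← riemannianExpMap_eq]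
    exact hq

omit [CovariantDerivative.ContMDiffCovariantDerivative g.leviCivita ∞] in
/-- From directional upper barriers for `d(p, ·)` at `x` to a bound on `Δ_g F(x)` for every
`C²` lower support function `F` of `d(p, ·)` at `x` (`F ≤ d(p, ·)` near `x`, `F(x) = d(p, x)`):
if `f` is a `g_x`-orthonormal frame with `card = dim M`, the radial barrier
`d(p, exp_x(σ f none)) ≤ T + σ` holds for `|σ| < T`, `T = d(p, x) > 0`, and for every `ε > 0`
the transverse barriers `d(p, exp_x(σ f o)) ≤ T + [o = none] σ + (Q o + εT)/2 · σ²` hold for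
`σ` near `0`, then `Δ_g F(x) ≤ Σₒ Q o − Q none` (`hessian_le_of_directional_barrier` in each
direction, `laplaceBeltrami_eq_sum_hessian`, `ε → 0`). [folklore] -/
theorem laplaceBeltrami_le_of_directional_barriers (hg : g.IsRiemannian)
    (hc : IsGeodesicallyComplete g.leviCivita) {p x : M} {T : ℝ} (hT : 0 < T)
    (hTx : T = (g.edist hg p x).toReal) {k : ℕ} {f : Option (Fin k) → TangentSpace 𝓘(ℝ, E) x}
    {Q : Option (Fin k) → ℝ} (hcard : Fintype.card (Option (Fin k)) = Module.finrank ℝ E)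
    (hon : ∀ o o', g.val x (f o) (f o') = if o = o' then 1 else 0)
    (hrad : ∀ σ ∈ Ioo (-T) T,
      (g.edist hg p (expMap g.leviCivita x (σ • f none))).toReal ≤ T + σ)
    (hbar : ∀ o, ∀ ε > 0, ∀ᶠ σ in 𝓝 (0 : ℝ),
      (g.edist hg p (expMap g.leviCivita x (σ • f o))).toReal ≤
        T + (if o = none then σ else 0) + (Q o + ε * T) / 2 * σ ^ 2)
    {F : M → ℝ} (hF : ∀ᶠ x' in 𝓝 x, ContMDiffAt 𝓘(ℝ, E) 𝓘(ℝ, ℝ) 2 F x')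
    (hle : ∀ᶠ x' in 𝓝 x, F x' ≤ (g.edist hg p x').toReal) (hFx : F x = (g.edist hg p x).toReal) :
    g.laplaceBeltrami F x ≤ (∑ o, Q o) - Q none := by
  classical
  have _ := hg
  haveI : Fact ((1 : ℕ∞ω) ≤ (∞ : ℕ∞ω)) := ⟨by exact_mod_cast le_top⟩
  -- the curves `σ ↦ exp_x(σ f o)` are continuous at `0` and start at `x`
  have hcurve : ∀ o, Tendsto (fun σ : ℝ ↦ expMap g.leviCivita x (σ • f o)) (𝓝 0) (𝓝 x) := by
    intro o
    have hgeo : IsGeodesic g.leviCivita (fun σ : ℝ ↦ expMap g.leviCivita x (σ • f o)) :=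
      isGeodesic_expMap_smul_of_isGeodesicallyComplete hc x (f o)
    have hcont : ContinuousAt (fun σ : ℝ ↦ expMap g.leviCivita x (σ • f o)) 0 :=
      (IsGeodesicOn.mdifferentiableAt_holds (hgeo.isGeodesicOn univ) (mem_univ 0)).continuousAt
    have h0 : expMap g.leviCivita x ((0 : ℝ) • f o) = x := by
      rw [zero_smul]; exact expMap_zero (cov := g.leviCivita) x
    have h := hcont.tendsto
    rwa [h0] at h
  -- `F ≤ d(p, ·)` along each curve, near `σ = 0`
  have hleo : ∀ o, ∀ᶠ σ in 𝓝 (0 : ℝ), F (expMap g.leviCivita x (σ • f o)) ≤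
      (g.edist hg p (expMap g.leviCivita x (σ • f o))).toReal := fun o ↦ (hcurve o).eventually hle
  have hF0 : F (expMap g.leviCivita x ((0 : ℝ) • f none)) = T ∧
      ∀ o, F (expMap g.leviCivita x ((0 : ℝ) • f o)) = T := by
    have h0 : ∀ o, expMap g.leviCivita x ((0 : ℝ) • f o) = x := fun o ↦ by
      rw [zero_smul]; exact expMap_zero (cov := g.leviCivita) x
    exact ⟨by rw [h0, hFx, hTx], fun o ↦ by rw [h0, hFx, hTx]⟩
  -- the radial direction: `Hess F(f none, f none) ≤ 0`
  have hnone : g.hessian F x (f none) (f none) ≤ 0 := by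
    refine hessian_le_of_directional_barrier g hc hF (f none) (B := fun σ ↦ T + σ)
      (B' := fun _ ↦ (1 : ℝ)) (Eventually.of_forall fun σ ↦ ?_) (hasDerivAt_const 0 (1 : ℝ)) ?_
    · simpa using (hasDerivAt_id σ).const_add T
    · have hIoo : Ioo (-T) T ∈ 𝓝 (0 : ℝ) := Ioo_mem_nhds (by linarith) hT
      show ∀ᶠ σ in 𝓝 (0 : ℝ), (T + 0) - F (expMap g.leviCivita x ((0 : ℝ) • f none)) ≤
        (T + σ) - F (expMap g.leviCivita x (σ • f none))
      filter_upwards [hIoo, hleo none] with σ hσ hσ'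
      rw [hF0.1]
      linarith [hrad σ hσ]
  -- the transverse directions: `Hess F(f o, f o) ≤ Q o + εT`
  have hsome : ∀ ε > 0, ∀ i : Fin k, g.hessian F x (f (some i)) (f (some i)) ≤ Q (some i) + ε * T := by
    intro ε hε i
    set c : ℝ := Q (some i) + ε * T with hc_def
    refine hessian_le_of_directional_barrier g hc hF (f (some i)) (B := fun σ ↦ T + c / 2 * σ ^ 2)
      (B' := fun σ ↦ c * σ) (Eventually.of_forall fun σ ↦ ?_) ?_ ?_
    · have h := ((hasDerivAt_pow 2 σ).const_mul (c / 2)).const_add T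
      exact h.congr_deriv (by norm_num; ring)
    · have h := (hasDerivAt_id (0 : ℝ)).const_mul c
      simpa using h
    · show ∀ᶠ σ in 𝓝 (0 : ℝ), (T + c / 2 * (0 : ℝ) ^ 2) - F (expMap g.leviCivita x ((0 : ℝ) • f (some i))) ≤
        (T + c / 2 * σ ^ 2) - F (expMap g.leviCivita x (σ • f (some i)))
      filter_upwards [hbar (some i) ε hε, hleo (some i)] with σ hσ hσ'
      rw [hF0.2]
      simp only [reduceCtorEq, if_false, add_zero] at hσ
      have : F (expMap g.leviCivita x (σ • f (some i))) ≤ T + c / 2 * σ ^ 2 := by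
        rw [hc_def]; linarith
      nlinarith
  -- sum over the frame and let `ε → 0`
  rw [laplaceBeltrami_eq_sum_hessian g x hon hcard F, Fintype.sum_option]
  have hQ : (∑ o, Q o) - Q none = ∑ i : Fin k, Q (some i) := by
    rw [Fintype.sum_option]; ring
  rw [hQ]
  refine le_of_forall_pos_le_add fun ε' hε' ↦ ?_
  have hkT : 0 < (k : ℝ) * T + T := by positivity
  set ε : ℝ := ε' / ((k : ℝ) * T + T) with hε_def
  have hε : 0 < ε := div_pos hε' hkT
  have hsum : ∑ i : Fin k, g.hessian F x (f (some i)) (f (some i)) ≤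
      ∑ i : Fin k, (Q (some i) + ε * T) := Finset.sum_le_sum fun i _ ↦ hsome ε hε i
  rw [Finset.sum_add_distrib, Finset.sum_const, Finset.card_univ, Fintype.card_fin,
    nsmul_eq_mul] at hsum
  have hkε : (k : ℝ) * (ε * T) ≤ ε' := by
    have h1 : (k : ℝ) * (ε * T) ≤ ((k : ℝ) * T + T) * ε := by nlinarith [hε.le, hT.le]
    have h2 : ((k : ℝ) * T + T) * ε = ε' := by
      rw [hε_def]; field_simp
    linarith
  linarith

/-- **Laplacian comparison for the distance function, `Ric ≥ -(m-1)`, viscosity form**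
(Calabi 1958; Cheeger–Colding 1996, §1; Lee 2018, Thm. 11.15 with Calabi's barrier trick). On a
connected Riemannian `m`-manifold with geodesically complete Levi-Civita connection and
`Ric ≥ -(m-1) g`: for `x ≠ p` and every function `F` that is `C²` near `x`, lies below
`d(p, ·)` near `x` and touches it at `x`,
  `Δ_g F(x) ≤ (m − 1) coth d(p, x)`
— i.e. `Δ d(p, ·) ≤ (m-1) coth d(p, ·)` on `M ∖ {p}` in the viscosity (equivalently, Calabi
barrier) sense; at points where `d(p, ·)` is itself `C²` this is the classical pointwise
inequality. [cite: LeeRiemannianManifolds2018, Thm. 11.15] [cite: CheegerColding1996, §1]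
[cite: Calabi1958] -/
theorem laplaceBeltrami_le_coth_of_le_edist [ConnectedSpace M] (hg : g.IsRiemannian)
    (hc : IsGeodesicallyComplete g.leviCivita)
    (hRic : ∀ (x : M) (w : TangentSpace 𝓘(ℝ, E) x),
      -((Module.finrank ℝ E : ℝ) - 1) * g.val x w w ≤ g.leviCivita.ricci x w w)
    {p x : M} (hxp : x ≠ p) {F : M → ℝ} (hF : ∀ᶠ x' in 𝓝 x, ContMDiffAt 𝓘(ℝ, E) 𝓘(ℝ, ℝ) 2 F x')
    (hle : ∀ᶠ x' in 𝓝 x, F x' ≤ (g.edist hg p x').toReal) (hFx : F x = (g.edist hg p x).toReal) :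
    g.laplaceBeltrami F x ≤ ((Module.finrank ℝ E : ℝ) - 1) *
      (Real.cosh (g.edist hg p x).toReal / Real.sinh (g.edist hg p x).toReal) := by
  obtain ⟨u, T, hu, hT, hTx, hx⟩ := exists_unit_speed_expMap_eq_of_ne g hg hc hxp
  subst hx
  obtain ⟨k, f, Q, hcard, hon, -, hrad, hbar, hsum⟩ := far_end_sinh_datum g hg hc hRic p u hu hT
  rw [← hTx]
  exact (laplaceBeltrami_le_of_directional_barriers g hg hc hT hTx hcard hon hrad hbar hF hle
    hFx).trans hsum

/-- **Laplacian comparison for the distance function, `Ric ≥ 0`, viscosity form** (Calabi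
1958; Lee 2018, Thm. 11.15): on a connected Riemannian `m`-manifold with geodesically complete
Levi-Civita connection and `Ric ≥ 0`, for `x ≠ p` and every `C²` lower support function `F` of
`d(p, ·)` at `x`, `Δ_g F(x) ≤ (m − 1)/d(p, x)`. [cite: LeeRiemannianManifolds2018, Thm. 11.15]
[cite: Calabi1958] -/
theorem laplaceBeltrami_le_div_of_le_edist [ConnectedSpace M] (hg : g.IsRiemannian)
    (hc : IsGeodesicallyComplete g.leviCivita)
    (hRic : ∀ (x : M) (w : TangentSpace 𝓘(ℝ, E) x), 0 ≤ g.leviCivita.ricci x w w)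
    {p x : M} (hxp : x ≠ p) {F : M → ℝ} (hF : ∀ᶠ x' in 𝓝 x, ContMDiffAt 𝓘(ℝ, E) 𝓘(ℝ, ℝ) 2 F x')
    (hle : ∀ᶠ x' in 𝓝 x, F x' ≤ (g.edist hg p x').toReal) (hFx : F x = (g.edist hg p x).toReal) :
    g.laplaceBeltrami F x ≤ ((Module.finrank ℝ E : ℝ) - 1) * (1 / (g.edist hg p x).toReal) := by
  obtain ⟨u, T, hu, hT, hTx, hx⟩ := exists_unit_speed_expMap_eq_of_ne g hg hc hxp
  subst hx
  obtain ⟨k, f, Q, hcard, hon, -, hrad, hbar, hsum⟩ :=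
    far_end_linear_datum_of_ricci_nonneg g hg hc hRic p u hu hT
  rw [← hTx]
  exact (laplaceBeltrami_le_of_directional_barriers g hg hc hT hTx hcard hon hrad hbar hF hle
    hFx).trans hsum

end Viscosity

end Literature.Geometry.Riemannian

end
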